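import Literature.Analysis.FluidPDE.OseenMildSlabChain
import Literature.Analysis.FluidPDE.SelfSimilar
import HarnessLib

/-! # Gluing the Oseen equation along the geometric chain of DSS slabs — crux stmt-NavierStokesRegularity-1404 (`QuantisedSymmetry.PolyhedralDssProfileExists`), line polyhedral_cell, stub stub_oseenMild_of_slabs

Registered stub `stub_oseenMild_of_slabs` (`--supports stmt-NavierStokesRegularity-1404`).
A field `u` on the past which, for a zoom factor `c > 1`, is jointly continuous on every closed slab
`[-(c²)ᵏ, -(c²)ᵏ⁻¹] × ℝ³` (`k ∈ ℤ`), satisfies the Oseen (Koch–Nadirashvili–Seregin–Šverák) integral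
equation `u(t) = e^{(t−s)Δ}u(s) − B¹ₛ(u,u)(t)` between all pairs of times of each slab, and obeys a
Type-I time rate `‖u(t, x)‖ ≤ M/√(−t)`, is jointly continuous on the open past `(−∞, 0) × ℝ³` and
satisfies the Oseen equation between ALL pairs `s < t < 0`.

Proof (restart/semigroup bookkeeping of KNSS 2009 §4 (4.4), assembled from the tree file
`Literature/Analysis/FluidPDE/OseenMildSlabChain.lean`). For `K ∈ ℤ` the junction times
`T n := -(c²)^(K−n)`, `n ∈ ℕ`, form a monotone chain starting at `-(c²)^K` whose slabs
`[T n, T (n+1)]` are exactly the DSS slabs of index `k = K − n`, and which exhausts the past: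
every `t < 0` lies below some `T n` because `(c²)^(K−n) → 0`. On each slab the Type-I rate gives
the uniform bound `|M|/√((c²)^(K−n−1))`. Hence `oseenMild_of_chain` yields the Oseen equation for
all `-(c²)^K ≤ s < t < 0` and `continuousOn_uncurry_Ico_of_chain` yields joint continuity on
`[-(c²)^K, 0) × ℝ³`; since `(c²)^K → ∞` every `s` (resp. every `t < 0`, with room to spare) lies
above some `-(c²)^K`, which gives the equation for all pairs and, `ContinuousOn` being a local
property (`continuousOn_of_locally_continuousOn`), continuity on the whole open past.
-/

noncomputable section

-- the summit namespace `…NavierStokesRegularity.NavierStokesRegularity…` is the tree convention (D-0017)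
set_option linter.dupNamespace false

namespace Summit.NavierStokesRegularity.NavierStokesRegularity.Theorems.PolyhedralDssProfileExists.PolyhedralCell

open MeasureTheory Set Function Filter Topology
open Literature.Analysis.FluidPDE

/-! ## The geometric chain of junction times `n ↦ -(q ^ (K - n))` -/

/-- For `1 < q` the junction times `n ↦ -(q ^ (K - n))` increase with `n`. -/
theorem geomChain_monotone {q : ℝ} (hq : 1 < q) (K : ℤ) :
    Monotone (fun n : ℕ => -(q ^ (K - (n : ℤ)))) := fun _ _ hmn =>
  neg_le_neg (zpow_le_zpow_right₀ hq.le (sub_le_sub_left (Nat.cast_le.2 hmn) K))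

/-- The exponent of the `(n+1)`-st junction time is one less than that of the `n`-th. -/
theorem geomChain_exponent_succ (K : ℤ) (n : ℕ) :
    K - ((n + 1 : ℕ) : ℤ) = K - (n : ℤ) - 1 := by
  push_cast
  ring

/-- For `1 < q` the junction times `-(q ^ (K - n))` exhaust the past: every `t < 0` lies strictly
below some junction time (`q ^ (K - n) = q ^ K / q ^ n → 0`). -/
theorem geomChain_exhaust {q : ℝ} (hq : 1 < q) (K : ℤ) :
    ∀ t < (0 : ℝ), ∃ n : ℕ, t < -(q ^ (K - (n : ℤ))) := by
  intro t ht
  have hq0 : 0 < q := zero_lt_one.trans hq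
  obtain ⟨n, hn⟩ := pow_unbounded_of_one_lt (q ^ K / -t) hq
  refine ⟨n, ?_⟩
  rw [zpow_sub₀ hq0.ne' , zpow_natCast]
  have h : q ^ K / q ^ n < -t := (div_lt_comm₀ (neg_pos.2 ht) (pow_pos hq0 n)).1 hn
  linarith

/-- For `1 < q` every real number lies strictly above some `-(q ^ K)`, `K ∈ ℤ`. -/
theorem exists_neg_zpow_lt {q : ℝ} (hq : 1 < q) (s : ℝ) : ∃ K : ℤ, -(q ^ K) < s := by
  obtain ⟨m, hm⟩ := pow_unbounded_of_one_lt (-s) hq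
  exact ⟨m, by rw [zpow_natCast]; linarith⟩

/-! ## The slab hypotheses along the chain -/

/-- Slabwise continuity, re-indexed along the chain `n ↦ -(q ^ (K - n))` (slab `k = K - n`). -/
theorem geomChain_continuousOn {X Y : Type*} [TopologicalSpace X] [TopologicalSpace Y]
    {v : ℝ → X → Y} {q : ℝ} (K : ℤ)
    (hcont : ∀ k : ℤ, ContinuousOn (uncurry v) (Icc (-(q ^ k)) (-(q ^ (k - 1))) ×ˢ univ))
    (n : ℕ) :
    ContinuousOn (uncurry v)
      (Icc (-(q ^ (K - (n : ℤ)))) (-(q ^ (K - ((n + 1 : ℕ) : ℤ)))) ×ˢ univ) := by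
  rw [geomChain_exponent_succ]
  exact hcont (K - n)

/-- The slabwise Oseen equation, re-indexed along the chain `n ↦ -(q ^ (K - n))`. -/
theorem geomChain_slab {E : Type*} [NormedAddCommGroup E] [InnerProductSpace ℝ E]
    [FiniteDimensional ℝ E] [MeasurableSpace E] [BorelSpace E] {v : ℝ → E → E} {q : ℝ} (K : ℤ)
    (hslab : ∀ k : ℤ, ∀ s t : ℝ, -(q ^ k) ≤ s → s < t → t ≤ -(q ^ (k - 1)) → ∀ x,
      v t x = heatFlow (v s) (t - s) x - oseenDuhamel 1 s v v t x) (n : ℕ) :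
    ∀ s t : ℝ, -(q ^ (K - (n : ℤ))) ≤ s → s < t → t ≤ -(q ^ (K - ((n + 1 : ℕ) : ℤ))) → ∀ x,
      v t x = heatFlow (v s) (t - s) x - oseenDuhamel 1 s v v t x := by
  rw [geomChain_exponent_succ]
  exact hslab (K - n)

/-- A Type-I time rate `‖v(t, x)‖ ≤ M/√(−t)` bounds `v` uniformly on every slab of the chain:
on `[-(q ^ (K-n)), -(q ^ (K-n-1))]` one has `-t ≥ q ^ (K-n-1) > 0`, whence
`‖v(t, x)‖ ≤ |M| / √(q ^ (K-n-1))`. -/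
theorem geomChain_bound {X F : Type*} [NormedAddCommGroup F] {v : ℝ → X → F} {q : ℝ}
    (hq : 1 < q) (K : ℤ) {M : ℝ} (hM : HasTypeITimeDecay M v) (n : ℕ) :
    ∃ M' : ℝ, ∀ τ ∈ Icc (-(q ^ (K - (n : ℤ)))) (-(q ^ (K - ((n + 1 : ℕ) : ℤ)))), ∀ y,
      ‖v τ y‖ ≤ M' := by
  have hδ : 0 < q ^ (K - ((n + 1 : ℕ) : ℤ)) := zpow_pos (zero_lt_one.trans hq) _
  refine ⟨|M| / Real.sqrt (q ^ (K - ((n + 1 : ℕ) : ℤ))), fun τ hτ y => ?_⟩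
  have hτ' : q ^ (K - ((n + 1 : ℕ) : ℤ)) ≤ -τ := by linarith [hτ.2]
  have hτ0 : τ < 0 := by linarith
  calc ‖v τ y‖ ≤ M / Real.sqrt (-τ) := hM τ hτ0 y
    _ ≤ |M| / Real.sqrt (-τ) := div_le_div_of_nonneg_right (le_abs_self M) (Real.sqrt_nonneg _)
    _ ≤ |M| / Real.sqrt (q ^ (K - ((n + 1 : ℕ) : ℤ))) :=
      div_le_div_of_nonneg_left (abs_nonneg M) (Real.sqrt_pos.2 hδ) (Real.sqrt_le_sqrt hτ')

/-! ## Gluing from `-(q ^ K)` up to the blow-up time -/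

/-- Joint continuity on `[-(q ^ K), 0) × X` from slabwise continuity
(`continuousOn_uncurry_Ico_of_chain` along the chain `n ↦ -(q ^ (K - n))`). -/
theorem continuousOn_Ico_of_slabs {X Y : Type*} [TopologicalSpace X] [TopologicalSpace Y]
    {v : ℝ → X → Y} {q : ℝ} (hq : 1 < q)
    (hcont : ∀ k : ℤ, ContinuousOn (uncurry v) (Icc (-(q ^ k)) (-(q ^ (k - 1))) ×ˢ univ))
    (K : ℤ) : ContinuousOn (uncurry v) (Ico (-(q ^ K)) 0 ×ˢ univ) := by
  have h := continuousOn_uncurry_Ico_of_chain (T := fun n : ℕ => -(q ^ (K - (n : ℤ))))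
    (geomChain_monotone hq K) (geomChain_continuousOn K hcont) (L := 0) (geomChain_exhaust hq K)
  simpa only [Nat.cast_zero, sub_zero] using h

/-- **The Oseen equation from `-(q ^ K)` on** (KNSS 2009 §4 (4.4), `oseenMild_of_chain` along the
chain `n ↦ -(q ^ (K - n))`): slabwise continuity, the slabwise Oseen equation and a Type-I time
rate give `v(t) = e^{(t−s)Δ}v(s) − B¹ₛ(v,v)(t)` for all `-(q ^ K) ≤ s < t < 0`. -/
theorem oseenMild_from_of_slabs {E : Type*} [NormedAddCommGroup E] [InnerProductSpace ℝ E]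
    [FiniteDimensional ℝ E] [MeasurableSpace E] [BorelSpace E] {v : ℝ → E → E} {q : ℝ}
    (hq : 1 < q)
    (hcont : ∀ k : ℤ, ContinuousOn (uncurry v) (Icc (-(q ^ k)) (-(q ^ (k - 1))) ×ˢ univ))
    {M : ℝ} (hM : HasTypeITimeDecay M v)
    (hslab : ∀ k : ℤ, ∀ s t : ℝ, -(q ^ k) ≤ s → s < t → t ≤ -(q ^ (k - 1)) → ∀ x,
      v t x = heatFlow (v s) (t - s) x - oseenDuhamel 1 s v v t x) (K : ℤ) :
    ∀ s t : ℝ, -(q ^ K) ≤ s → s < t → t < 0 → ∀ x,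
      v t x = heatFlow (v s) (t - s) x - oseenDuhamel 1 s v v t x := by
  have h := oseenMild_of_chain (T := fun n : ℕ => -(q ^ (K - (n : ℤ)))) (geomChain_monotone hq K)
    (geomChain_continuousOn K hcont) (geomChain_bound hq K hM) (geomChain_slab K hslab) (L := 0)
    (geomChain_exhaust hq K)
  simpa only [Nat.cast_zero, sub_zero] using h

/-! ## The registered stub -/

/-- **Stub `stub_oseenMild_of_slabs` (line `polyhedral_cell`, crux `PolyhedralDssProfileExists`).**
For a zoom factor `c > 1`, a field `u` on the past which is jointly continuous on every closed DSS
slab `[-(c²)ᵏ, -(c²)ᵏ⁻¹] × ℝ³`, `k ∈ ℤ`, obeys a Type-I time rate `‖u(t, x)‖ ≤ M/√(−t)` and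
satisfies the Oseen integral equation `u(t) = e^{(t−s)Δ}u(s) − B¹ₛ(u,u)(t)` between all pairs of
times of each slab, is jointly continuous on `(−∞, 0) × ℝ³` and satisfies the Oseen equation
between all pairs `s < t < 0` (finite chains of slabs glued by the semigroup law and the restart
identity of the Duhamel term, KNSS 2009 §4 (4.4): `oseenMild_of_chain`,
`continuousOn_uncurry_Ico_of_chain`; every `s` lies above some `-(c²)^K`). -/
theorem stub_oseenMild_of_slabs :
    ∀ (c : ℝ), 1 < c → ∀ u : ℝ → EuclideanSpace ℝ (Fin 3) → EuclideanSpace ℝ (Fin 3),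
      (∀ k : ℤ, ContinuousOn (Function.uncurry u)
        (Set.Icc (-((c ^ 2) ^ k)) (-((c ^ 2) ^ (k - 1))) ×ˢ Set.univ)) →
      (∃ M : ℝ, HasTypeITimeDecay M u) →
      (∀ k : ℤ, ∀ s t : ℝ, -((c ^ 2) ^ k) ≤ s → s < t → t ≤ -((c ^ 2) ^ (k - 1)) → ∀ x,
        u t x = heatFlow (u s) (t - s) x - oseenDuhamel 1 s u u t x) →
      ContinuousOn (Function.uncurry u) (Set.Iio 0 ×ˢ Set.univ) ∧
        ∀ s t : ℝ, s < t → t < 0 → ∀ x,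
          u t x = heatFlow (u s) (t - s) x - oseenDuhamel 1 s u u t x := by
  intro c hc u hcont hM hslab
  obtain ⟨M, hM⟩ := hM
  have hq : 1 < c ^ 2 := one_lt_pow₀ hc two_ne_zero
  refine ⟨?_, fun s t hst ht x => ?_⟩
  · -- continuity is local: near a time `t₀ < 0` use the chain starting below `t₀`
    refine continuousOn_of_locally_continuousOn fun p hp => ?_
    rw [mem_prod, mem_Iio] at hp
    obtain ⟨K, hK⟩ := exists_neg_zpow_lt hq p.1
    refine ⟨Ioi (-((c ^ 2) ^ K)) ×ˢ univ, isOpen_Ioi.prod isOpen_univ, ⟨hK, mem_univ _⟩, ?_⟩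
    refine (continuousOn_Ico_of_slabs hq hcont K).mono fun r hr => ?_
    simp only [mem_inter_iff, mem_prod, mem_Iio, mem_Ioi, mem_univ, and_true] at hr
    exact ⟨⟨hr.2.le, hr.1⟩, mem_univ _⟩
  · -- the Oseen equation: start the chain below `s`
    obtain ⟨K, hK⟩ := exists_neg_zpow_lt hq s
    exact oseenMild_from_of_slabs hq hcont hM hslab K s t hK.le hst ht x

end Summit.NavierStokesRegularity.NavierStokesRegularity.Theorems.PolyhedralDssProfileExists.PolyhedralCell

end
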